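import Mathlib
import Literature.Computability.Complexity.ExtMonotoneGates
import Literature.Computability.Complexity.ExtMonotoneGRankSupport
import Literature.Computability.Complexity.CliqueApproximatorsWide
import Literature.Computability.Complexity.RossmanMonotoneCliqueProb
import Literature.LinearAlgebra.Matrix.RankMinors
import Summits.PneNP.PneNP.Theses.ConvexRankGates
import Literature.Computability.Complexity.RossmanMonotoneCliqueGraphs
import Summits.PneNP.PneNP.Theorems.ConvexRankGatesLinAlgGateBlindDefs
import Summits.PneNP.PneNP.Theorems.ConvexRankGatesLinAlgGateBlindDenseRegime
import Summits.PneNP.PneNP.Theorems.ConvexRankGatesLinAlgGateBlindTermCollapse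
import Summits.PneNP.PneNP.Theorems.ConvexRankGatesLinAlgGateBlindPluckingBound
import Summits.PneNP.PneNP.Theorems.ConvexRankGatesLinAlgGateBlindWideApproxHost
import Summits.PneNP.PneNP.Theorems.ConvexRankGatesLinAlgGateBlindKonigDuality
import Summits.PneNP.PneNP.Theorems.LinAlgGateBlind.Negative.DetGate
import Summits.PneNP.PneNP.Theorems.LinAlgGateBlind.Negative.CliquePolyDetRepr
import Summits.PneNP.PneNP.Theorems.LinAlgGateBlind.Negative.OnePermGate
import Summits.PneNP.PneNP.Theorems.LinAlgGateBlind.Negative.ValiantCertificate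

/-!
# Skeleton line `konig-atoms-cancellation-split` for crux `LinAlgGateBlind` (stmt-PneNP-10681) — rev 2 (lead c1, 2026-08-16)

STATUS (lead prover-line-stmt-PneNP-10681-c1-0): the three restated host stubs and `stub_konigDuality` are now discharged by the
LANDED theorems (`…DnfInvariantWideGatesSeeSmallCliques.stub_termCollapse` p80791, `stub_pluckingBound` p80095,
`stub_wideApproxHost` p78695, `Summit.PneNP.PneNP.Theorems.konigDuality_pattern`), so `sorry` remains ONLY in the three research
stubs `stub_sgPerm`, `stub_sgHallCover`, `stub_sgCancelling`; `LinAlgGateBlind_closed` proves the crux BY NAME modulo exactly these.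
Line verdict: `Lines/konig-atoms-cancellation-split-dead.md` (dead at the Valiant-hard pair {sgHallCover, sgCancelling}).

Route `PneNP/ConvexRankGates`; crux decl `Summit.PneNP.PneNP.Theses.ConvexRankGates.LinAlgGateBlind`
(`∃ δ ∈ (0,1/2), ∀ c, ∀ᶠ m, no circuit with ≤ m^c gates over {∧₂,∨₂} ∪ PERM_{m^c} ∪ GRANK_{m^c} computes
CLIQUE(m, ⌈m^δ⌉₊)`); idea card `Cruxes/LinAlgGateBlind/Ideas/konig-atoms-cancellation-split.md` (ideator 2;
triage r1: fail (r1-1) / pass (r1-2) / pass (r1-3); merged target with `theta-budget-flat-certificates`).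

THE LINE. The host is the LANDED approximation-method reduction of the picked line
`dnf-invariant-wide-gates-see-small-cliques` (tree: `Theorems/ConvexRankGatesLinAlgGateBlind{Defs,TermCollapse,
PluckingBound,WideApproxHost,DenseRegime}.lean`, all proved; `Defs` and `DenseRegime` are imported, the other
three are RESTATED VERBATIM as the sorried `stub_termCollapse` / `stub_pluckingBound` / `stub_wideApproxHost`
below — same names, same signatures, same namespace-opened vocabulary as the landed theorems — only because their
oleans were not yet served by the farm when this skeleton was checked (`remote:…:unbuilt`); they are CLOSED in the
tree and the three restatements are to be replaced by the three imports mechanically): the crux follows from the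
two single-gate
statements SG(PERM) and SG(GRANK) — every PERM / GRANK TERM GATE (one wide gate fed with clique atoms `⌈X⌉`,
`#X ≤ l`) is one-sidedly `ε`-approximable by a small-clique DNF on the referee pair (bare `k`-cliques ×
`G(m,q)`), `δ = 1/8`. This line CUTS THE GRANK HALF AT THE KÖNIG JOINT. A GRANK gate
`[θ ≤ rank_{F(x)} (K₀ + Σ_{on i} xᵢ Kᵢ)]` is dominated by the KÖNIG GATE of its support patterns — the
bipartite `θ`-matching test on the OR-pattern `supp K₀ ∪ ⋃_{on i} supp Kᵢ` (generic rank ≤ term rank,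
Frobenius–Kőnig; PROVED here: `hasMatching_of_le_rank_symbolicMatrix`, `grank_le_konig`), with equality
exactly when the constants do not cancel (Edmonds 1967: generic entries). König gates (`IsKonigGate`) are the
CANCELLATION-FREE layer of GRANK: they contain every monotone CNF of `d` clauses (PROVED: `cnf_isKonigGate`),
bipartite matching, and — by Edmonds/total unimodularity — lie in GRANK_d ∩ CONV_{3d²+1}; and CLIQUE(m,k)
itself is ONE König gate of dimension `≤ 2 + C(m,k)·C(k,2)` (the parallel-paths ABP pattern: rows/columns = ABP
nodes minus source/sink, internal nodes own their diagonal cell, edge `e ⊆ T` owns the cell of its arc on the path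
of `T`; a perfect matching exists iff some source–sink path survives iff some `k`-set is a clique — the cut of a
dead ABP is a Hall violator), the König twin of the Disproof's one-gate constructions at `d = m^{Θ(k)}`
(`Negative.exists_oneGRankGate_computes_cliqueFn`, `exists_onePermGate_computes_cliqueFn`). Kőnig–Egerváry
duality (`stub_konigDuality`,
Kőnig 1931; Mathlib has Hall only) hands every REJECTED input an explicit certificate: a vertex cover `(A, W)`,
`#A + #W < θ`, of the on-pattern — equivalently a rectangle `Aᶜ × Wᶜ` of cells all of whose owning atoms are
absent (`IsHallCoverGate`, the dual presentation). The four stubs OF THE LINE (plus the three landed host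
restatements `stub_termCollapse`, `stub_pluckingBound`, `stub_wideApproxHost`, see above):

* `stub_sgPerm` — SG for PERM term gates (SHARED verbatim with the picked line; registered there).
* `stub_konigDuality` — Kőnig's theorem for patterns `P ⊆ [d]²`: if every vertex cover has `≥ θ` vertices then
  `P` has a `θ`-matching (provable now, M; the easy converse `cover_card_ge_of_hasMatching` is proved here).
* `stub_sgHallCover` — LOAD-BEARING AND NEW: SG for HALL-COVER term gates of dimension `≤ m^c` (= König gates in
  certificate form): on the referee pair, a `d × d` table of atom-sets whose small vertex covers must swallow a
  Turán-size clique transversal cannot reject `ε` of the dense random graphs while accepting `ε·C(m,k)` bare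
  cliques non-locally. Skyum–Valiant reading: CLIQUE(m, m^{1/8}) is not, even distributionally, a monotone
  bounded-OR-projection of BPM_{m^c} over `≤ l`-clique atoms. Counting proves the DOOR version (all cliques
  accepted ⇒ ≤ 1/2 + ε of G(m,q) rejected; `konigDoor_of_sg` below derives the door version from the stub) for
  edge-atom gates of dimension `d ≤ m^{2-δ}/polylog` (card BN2, triage r1-2); the lead's planting theorem
  `sg_of_maxtermCover` (registered on the crux) proves the SG version from the `≤ 4^d` covers for
  `d ≤ m^{3/4-o(1)}`; `m^{3/4} ≲ d ≤ m^c` is open and unbarred (no algebraic barrier: no cancellation; not a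
  lifting/rank-measure statement).
* `stub_sgCancelling` — the QUARANTINED Valiant-hard residue: SG for GRANK term gates whose function is NOT a
  König gate of parameter `m^c` over `≤ l`-atoms ("essentially cancelling" gates = the VBP-power beyond monotone
  projections of matching). By the Disproof headline / `sgAt_gRank_dc_lowerBound` this stub, together with
  `stub_sgHallCover`, forces `dc(CL_{m,⌈m^{1/8}⌉}) > m^c`; it is isolated, not attacked, by this line.

`sgGRank_of_split : KonigDualityStmt → SGHallCover → SGCancelling → SGGRank` (PROVED, excluded middle on
"is the term gate König-presentable") refines the picked line's `stub_sgGRank`; `LinAlgGateBlind_of` composes the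
seven stub statements (three landed host restatements + the four of the line) with the imported `Defs` /
`stub_denseRegime` into the crux BY NAME (`δ := 1/8`; real proof, no `sorry`); `LinAlgGateBlind_closed` feeds
it the stubs.

DISPROOF USED (`Cruxes/LinAlgGateBlind/Disproof.lean` gen 2; the landed `Theorems/LinAlgGateBlind/Negative/*`
files are imported and co-elaborate): (a) `not_withoutSizeBound` / `not_withoutBasis` — spent inside the landed
host (`stub_wideApproxHost`: `t = m^c` in both union bounds; monotonicity of every gate); `not_withoutGRankDim`,
`not_blindDim_pow_kOf` — `stub_sgHallCover` is asked only at dimension `≤ m^c`: CLIQUE itself is a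
Hall-cover/König term gate of dimension `≤ 2 + C(m,k)·C(k,2) ≤ m^{k+2}` (parallel-paths pattern above) for which
SG is FALSE (it accepts every clique and rejects `≥ 3/4` of `G(m,q)`; `konigDoor_of_sg`), so the stub genuinely
spends `d ≤ m^c` and its threshold lies in the window `m^{O(1)} ≤ d < m^{Θ(m^δ)}`; `not_withoutPermDim`,
`not_blindPermOnly_pow_kOf` — likewise for `stub_sgPerm`; `not_blindConstK`, `blind_window`,
`not_uniformThreshold` — `δ = 1/8` fixed, every stub `∀ c, ∀ᶠ m`, `k → ∞` used in the landed `stub_denseRegime`.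
(b) headline `dc_cliquePoly_superpolynomial_of_linAlgGateBlind` — inherited by `stub_sgCancelling` (jointly with
`stub_sgHallCover`; the tree's `sgAt_gRank_dc_lowerBound` makes the calibration formal for SG(GRANK)).
(d) `Sketch3Copy.not_shadowCliqueCover` — other card; no stub here has that shape. No stub is an instance of a
landed Negative lemma (those are one-gate CONSTRUCTIONS at dimension `≥ 1 + C(m,k)·#E ≫ m^c`).

Conventions: `sorry` appears ONLY inside the seven `stub_*` theorems (three of which are landed theorems restated);
every other declaration is proved. The vocabulary `kOf lOf rOf qOf epsOf atomB acceptsB IsTermGate lostPos gainedNeg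
SGAt GateApprox` is the LANDED `Theorems/ConvexRankGatesLinAlgGateBlindDefs.lean` (namespace
`…Cruxes.LinAlgGateBlind.DnfInvariantWideGatesSeeSmallCliques`, opened below), so `stub_sgPerm`, `stub_termCollapse`,
`stub_pluckingBound`, `stub_wideApproxHost` are literally the picked line's registered statements.
-/

set_option linter.unusedVariables false
set_option linter.unusedSectionVars false
set_option linter.dupNamespace false

namespace Summit.PneNP.PneNP.Cruxes.LinAlgGateBlind.KonigAtomsCancellationSplit

open scoped BigOperators
open Finset Filter Literature.Computability.Complexity Razborov
open Summit.PneNP.PneNP.Cruxes.LinAlgGateBlind.DnfInvariantWideGatesSeeSmallCliques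

noncomputable section

/-! ### §0 The crux read back with named pieces -/

/-- `Lin s = PERM_s ∪ GRANK_s`, the wide gates of the crux (the route's inline `let Lin`; texts of
`IsPermGate`/`IsGRankGate` are literally those disjuncts). [folklore] -/
def Lin (s : ℕ) : Set GateFn := {g | IsPermGate s g ∨ IsGRankGate s g}

/-- The basis of the crux: `{∧₂, ∨₂} ∪ Lin s` (`= monotoneBasis ∪ Lin s` by `rfl`). [folklore] -/
def basis (s : ℕ) : Set GateFn := {GateFn.and 2, GateFn.or 2} ∪ Lin s

/-- The inner statement of the crux at exponent `δ` (clique size `⌈m^δ⌉₊`). [folklore] -/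
def BlindAt (δ : ℝ) : Prop :=
  ∀ c : ℕ, ∀ᶠ m : ℕ in atTop, ∀ C : Circuit (KEdge m),
    C.IsOver (basis (m ^ c)) → C.size ≤ m ^ c → ¬ C.Computes (cliqueFn m ⌈(m : ℝ) ^ δ⌉₊)

/-- **Read-back** (as in `Disproof.linAlgGateBlind_iff`): the crux IS `∃ δ ∈ (0,1/2), BlindAt δ`, by `Iff.rfl`
(the inline clique function is `cliqueFn`, the inline gate classes are `IsPermGate`/`IsGRankGate`). -/
theorem linAlgGateBlind_iff :
    Summit.PneNP.PneNP.Theses.ConvexRankGates.LinAlgGateBlind ↔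
      ∃ δ : ℝ, 0 < δ ∧ δ < 1 / 2 ∧ BlindAt δ := Iff.rfl

/-- `basis s = {∧₂, ∨₂} ∪ Lin s` with the tree's name for the monotone basis. -/
theorem basis_eq (s : ℕ) : basis s = monotoneBasis ∪ Lin s := rfl

/-- Every `Lin` gate computes a monotone Boolean function (tree: `IsPermGate.monotone`,
`IsGRankGate.monotone`). -/
theorem lin_monotone {s : ℕ} {g : GateFn} (hg : g ∈ Lin s) : Monotone g.2 := by
  rcases hg with hg | hg
  · exact hg.monotone
  · exact hg.monotone

/-! ### §1 König gates: matchings, OR-patterns, vertex covers, the dual (Hall-cover) presentation -/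

/-- A **`θ`-matching** in a pattern `P ⊆ [d] × [d]`: `θ` cells of `P` with pairwise distinct rows and pairwise
distinct columns (a partial transversal of size `θ`). [folklore] -/
def HasMatching {d : ℕ} (θ : ℕ) (P : Set (Fin d × Fin d)) : Prop :=
  ∃ (r c : Fin θ → Fin d), Function.Injective r ∧ Function.Injective c ∧ ∀ j, (r j, c j) ∈ P

/-- Matchings survive enlarging the pattern. [folklore] -/
theorem HasMatching.mono {d θ : ℕ} {P Q : Set (Fin d × Fin d)} (h : HasMatching θ P) (hPQ : P ⊆ Q) :
    HasMatching θ Q := by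
  obtain ⟨r, c, hr, hc, hP⟩ := h
  exact ⟨r, c, hr, hc, fun j => hPQ (hP j)⟩

/-- The **OR-pattern** of pattern data `(P₀, P)` at input `v`: the always-on cells `P₀` together with the cells
OWNED by a switched-on input (`(a,w) ∈ P i`, `v i = 1`; the card's atoms `Z_{aw} = {i : (a,w) ∈ P i}` read
backwards). [folklore] -/
def orPattern {d n : ℕ} (P₀ : Set (Fin d × Fin d)) (P : Fin n → Set (Fin d × Fin d)) (v : Fin n → Bool) :
    Set (Fin d × Fin d) :=
  {x | x ∈ P₀ ∨ ∃ i, v i = true ∧ x ∈ P i}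

/-- The OR-pattern grows with the input. [folklore] -/
theorem orPattern_mono {d n : ℕ} (P₀ : Set (Fin d × Fin d)) (P : Fin n → Set (Fin d × Fin d))
    {v w : Fin n → Bool} (hvw : v ≤ w) : orPattern P₀ P v ⊆ orPattern P₀ P w := by
  rintro x (hx | ⟨i, hi, hx⟩)
  · exact Or.inl hx
  · exact Or.inr ⟨i, eq_true_of_le_of_eq_true (hvw i) hi, hx⟩

/-- `(A, W)` is a **vertex cover** of the pattern `P`: every cell of `P` lies in a row of `A` or a column of `W`.
[folklore] -/
def IsCover {d : ℕ} (A W : Finset (Fin d)) (P : Set (Fin d × Fin d)) : Prop :=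
  ∀ x ∈ P, x.1 ∈ A ∨ x.2 ∈ W

/-- **KÖNIG gates** of dimension `≤ s` (bipartite-matching gates on an OR-pattern; the cancellation-free layer
of GRANK): pattern data `P₀, Pᵢ ⊆ [d] × [d]`, `d ≤ s`, threshold `θ`; `g` accepts `v` iff the OR-pattern at `v`
has a `θ`-matching. With GENERIC entries on the patterns this is exactly a GRANK gate of dimension `d`
(Edmonds 1967, §5 Thm 1: rank of a matrix of distinct indeterminates = term rank); as an LP it is one totally
unimodular CONV gate (triage r1-1). [folklore] -/
def IsKonigGate (s : ℕ) (g : GateFn) : Prop :=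
  ∃ d θ : ℕ, d ≤ s ∧ ∃ (P₀ : Set (Fin d × Fin d)) (P : Fin g.1 → Set (Fin d × Fin d)),
    ∀ v : Fin g.1 → Bool, g.2 v = true ↔ HasMatching θ (orPattern P₀ P v)

/-- **HALL-COVER gates** of dimension `≤ s`: the DUAL (certificate) presentation — `g` REJECTS `v` iff some
vertex cover `(A, W)` with `#A + #W < θ` covers the OR-pattern at `v`, i.e. iff the rectangle `Aᶜ × Wᶜ` avoids
`P₀` and every atom owning a cell of it is off (a Hall violator; the card's "rectangle of atoms all deleted").
Equal to `IsKonigGate s` by Kőnig–Egerváry (`isHallCoverGate_iff_isKonigGate`, from `stub_konigDuality`).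
[folklore] -/
def IsHallCoverGate (s : ℕ) (g : GateFn) : Prop :=
  ∃ d θ : ℕ, d ≤ s ∧ ∃ (P₀ : Set (Fin d × Fin d)) (P : Fin g.1 → Set (Fin d × Fin d)),
    ∀ v : Fin g.1 → Bool, g.2 v = false ↔ ∃ A W : Finset (Fin d), #A + #W < θ ∧ IsCover A W (orPattern P₀ P v)

/-- KÖNIG_s ⊆ KÖNIG_t for `s ≤ t`. [folklore] -/
theorem IsKonigGate.mono {s t : ℕ} {g : GateFn} (h : IsKonigGate s g) (hst : s ≤ t) : IsKonigGate t g := by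
  obtain ⟨d, θ, hd, hrest⟩ := h
  exact ⟨d, θ, hd.trans hst, hrest⟩

/-- HALLCOVER_s ⊆ HALLCOVER_t for `s ≤ t`. [folklore] -/
theorem IsHallCoverGate.mono {s t : ℕ} {g : GateFn} (h : IsHallCoverGate s g) (hst : s ≤ t) :
    IsHallCoverGate t g := by
  obtain ⟨d, θ, hd, hrest⟩ := h
  exact ⟨d, θ, hd.trans hst, hrest⟩

/-- **König gates are monotone** (more inputs on, larger OR-pattern, matchings survive). [folklore] -/
theorem IsKonigGate.monotone {s : ℕ} {g : GateFn} (h : IsKonigGate s g) : Monotone g.2 := by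
  obtain ⟨d, θ, -, P₀, P, hg⟩ := h
  exact monotone_of_forall_iff hg fun v w hvw hv => hv.mono (orPattern_mono P₀ P hvw)

/-- A cover of a larger pattern covers a smaller one. [folklore] -/
theorem IsCover.anti {d : ℕ} {A W : Finset (Fin d)} {P Q : Set (Fin d × Fin d)} (h : IsCover A W Q)
    (hPQ : P ⊆ Q) : IsCover A W P := fun x hx => h x (hPQ hx)

/-- **Hall-cover gates are monotone** (a small cover of the larger OR-pattern covers the smaller one). [folklore] -/
theorem IsHallCoverGate.monotone {s : ℕ} {g : GateFn} (h : IsHallCoverGate s g) : Monotone g.2 := by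
  obtain ⟨d, θ, -, P₀, P, hg⟩ := h
  intro v w hvw
  cases hw : g.2 w with
  | true => exact le_top
  | false =>
    obtain ⟨A, W, hAW, hcov⟩ := (hg w).1 hw
    have hv : g.2 v = false := (hg v).2 ⟨A, W, hAW, hcov.anti (orPattern_mono P₀ P hvw)⟩
    rw [hv]

/-- **The easy half of Kőnig–Egerváry**: a `θ`-matching forces every vertex cover to have `≥ θ` vertices (each
matching cell consumes its own cover vertex). [folklore] -/
theorem cover_card_ge_of_hasMatching {d θ : ℕ} {P : Set (Fin d × Fin d)} (h : HasMatching θ P)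
    {A W : Finset (Fin d)} (hcov : IsCover A W P) : θ ≤ #A + #W := by
  classical
  obtain ⟨r, c, hr, hc, hP⟩ := h
  -- matching cells covered by their row, and the rest (covered by their column)
  set JA : Finset (Fin θ) := univ.filter fun j => r j ∈ A with hJA
  set JW : Finset (Fin θ) := univ.filter fun j => r j ∉ A with hJW
  have hJW_col : ∀ j ∈ JW, c j ∈ W := fun j hj => by
    rcases hcov _ (hP j) with h | h
    · exact absurd h (mem_filter.1 hj).2
    · exact h
  have h1 : #JA ≤ #A := by
    calc #JA ≤ #(JA.image r) := (card_image_of_injOn fun _ _ _ _ h => hr h).ge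
      _ ≤ #A := card_le_card fun a ha => by
          obtain ⟨j, hj, rfl⟩ := mem_image.1 ha
          exact (mem_filter.1 hj).2
  have h2 : #JW ≤ #W := by
    calc #JW ≤ #(JW.image c) := (card_image_of_injOn fun _ _ _ _ h => hc h).ge
      _ ≤ #W := card_le_card fun w hw => by
          obtain ⟨j, hj, rfl⟩ := mem_image.1 hw
          exact hJW_col j hj
  have h3 : #JA + #JW = θ := by
    have := Finset.card_filter_add_card_filter_not (s := (univ : Finset (Fin θ))) (fun j => r j ∈ A)
    simpa [hJA, hJW] using this
  omega

/-! ### §2 GRANK ≤ KÖNIG: the cancellation-free majorant (Frobenius–Kőnig, easy direction) -/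

section Majorant

variable {F : Type*} [Field F] {n d : ℕ}

/-- The **support pattern** of a constant matrix. [folklore] -/
def suppPat (M : Matrix (Fin d) (Fin d) F) : Set (Fin d × Fin d) := {x | M x.1 x.2 ≠ 0}

/-- An entry of the symbolic matrix `K₀ + Σ_{on i} Xᵢ Kᵢ` outside the OR-pattern of the supports vanishes.
[folklore] -/
theorem symbolicMatrix_apply_eq_zero (K₀ : Matrix (Fin d) (Fin d) F) (K : Fin n → Matrix (Fin d) (Fin d) F)
    (v : Fin n → Bool) {a b : Fin d} (h0 : K₀ a b = 0) (h : ∀ i, v i = true → K i a b = 0) :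
    symbolicMatrix K₀ K v a b = 0 := by
  simp only [symbolicMatrix, Matrix.add_apply, Matrix.map_apply, h0, map_zero, zero_add]
  rw [Matrix.sum_apply]
  refine Finset.sum_eq_zero fun i _ => ?_
  by_cases hv : v i = true
  · simp [hv, Matrix.smul_apply, Matrix.map_apply, h i hv]
  · simp [hv]

/-- **Generic rank ≤ term rank** (Frobenius 1912 / Kőnig 1915, easy direction; Edmonds 1967 §5 for the
converse with generic entries): if `θ ≤ rank (K₀ + Σ_{on i} Xᵢ Kᵢ)` then the OR-pattern of the supports at `v`
has a `θ`-matching — a non-zero `θ × θ` minor has a non-zero Leibniz term, whose cells are non-zero entries in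
distinct rows and columns. [folklore] -/
theorem hasMatching_of_le_rank_symbolicMatrix (K₀ : Matrix (Fin d) (Fin d) F)
    (K : Fin n → Matrix (Fin d) (Fin d) F) (v : Fin n → Bool) {θ : ℕ}
    (hθ : θ ≤ (symbolicMatrix K₀ K v).rank) :
    HasMatching θ (orPattern (suppPat K₀) (fun i => suppPat (K i)) v) := by
  classical
  obtain ⟨r, c, hr, hc, hdet⟩ :=
    Literature.LinearAlgebra.Matrix.exists_det_submatrix_ne_zero_of_le_rank _ hθ
  rw [Matrix.det_apply'] at hdet
  obtain ⟨σ, -, hσ⟩ := Finset.exists_ne_zero_of_sum_ne_zero hdet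
  have hprod : ∏ j, ((symbolicMatrix K₀ K v).submatrix r c) (σ j) j ≠ 0 := right_ne_zero_of_mul hσ
  refine ⟨fun j => r (σ j), c, hr.comp σ.injective, hc, fun j => ?_⟩
  have hj : symbolicMatrix K₀ K v (r (σ j)) (c j) ≠ 0 := by
    have := (Finset.prod_ne_zero_iff.1 hprod) j (Finset.mem_univ _)
    simpa [Matrix.submatrix_apply] using this
  by_contra hnot
  apply hj
  simp only [orPattern, suppPat, Set.mem_setOf_eq, not_or, not_exists, not_and, not_not] at hnot
  exact symbolicMatrix_apply_eq_zero K₀ K v hnot.1 fun i hi => hnot.2 i hi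

open Classical in
/-- **The König majorant of GRANK data is a König gate of the same dimension.** [folklore] -/
theorem isKonigGate_majorant {s θ : ℕ} (hd : d ≤ s) (K₀ : Matrix (Fin d) (Fin d) F)
    (K : Fin n → Matrix (Fin d) (Fin d) F) :
    IsKonigGate s ⟨n, fun v => decide (HasMatching θ (orPattern (suppPat K₀) (fun i => suppPat (K i)) v))⟩ :=
  ⟨d, θ, hd, suppPat K₀, fun i => suppPat (K i), fun v => decide_eq_true_iff⟩

open Classical in
/-- **GRANK ≤ KÖNIG pointwise** (`O ≤ M_O`): the GRANK gate of the data `(F, d, θ, K₀, K)` implies its König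
majorant at every input. Cancellation among the constants can only DELETE acceptance; the card's layer (ii)
is exactly the gap `M_O ∧ ¬O`. [folklore] -/
theorem grank_le_konig {θ : ℕ} (K₀ : Matrix (Fin d) (Fin d) F) (K : Fin n → Matrix (Fin d) (Fin d) F)
    {f : (Fin n → Bool) → Bool} (hf : ∀ v, f v = true ↔ θ ≤ (symbolicMatrix K₀ K v).rank)
    (v : Fin n → Bool) (hv : f v = true) :
    decide (HasMatching θ (orPattern (suppPat K₀) (fun i => suppPat (K i)) v)) = true :=
  decide_eq_true (hasMatching_of_le_rank_symbolicMatrix K₀ K v ((hf v).1 hv))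

end Majorant

/-- **Lost positives are antitone in the function**: if `O ≤ M` pointwise then every clique lost by `(O, 𝒜)` is
lost by `(M, 𝒜)`. With `grank_le_konig`: the POSITIVE side of SG for a GRANK term gate is bounded by that of its
König majorant term gate; only the negative side (`gainedNeg`) sees cancellation. [folklore] -/
theorem lostPos_subset_of_le {m k : ℕ} {O M : (KEdge m → Bool) → Bool} (hOM : ∀ x, O x = true → M x = true)
    (𝒜 : Finset (Finset (Fin m))) : lostPos m k O 𝒜 ⊆ lostPos m k M 𝒜 := by
  intro S hS
  simp only [lostPos, mem_filter] at hS ⊢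
  exact ⟨hS.1, hOM _ hS.2.1, hS.2.2⟩

/-- **Monotone CNFs are König gates**: the CNF `⋀_{j < T} ⋁_{i ∈ Cl j} vᵢ` is a König gate of dimension `T`
(diagonal pattern: clause `j` owns cell `(j, j)`, threshold `T`). So the König layer contains every poly-size
monotone CNF over clique atoms; conversely a König gate of dimension `d` is a CNF with `≤ 4^d` clauses (its Hall
covers), which is why `stub_sgHallCover` is stated for covers, not clauses. [folklore] -/
theorem cnf_isKonigGate {n T : ℕ} (Cl : Fin T → Finset (Fin n)) :
    IsKonigGate T ⟨n, fun v => decide (∀ j, ∃ i ∈ Cl j, v i = true)⟩ := by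
  refine ⟨T, T, le_rfl, ∅, fun i => {x | x.1 = x.2 ∧ i ∈ Cl x.1}, fun v => ?_⟩
  simp only [decide_eq_true_eq]
  constructor
  · intro h
    refine ⟨id, id, Function.injective_id, Function.injective_id, fun j => Or.inr ?_⟩
    obtain ⟨i, hi, hvi⟩ := h j
    exact ⟨i, hvi, rfl, hi⟩
  · rintro ⟨r, c, hr, -, hcell⟩ j'
    have hsurj : Function.Surjective r := Finite.surjective_of_injective hr
    obtain ⟨j, rfl⟩ := hsurj j'
    rcases hcell j with h | ⟨i, hvi, -, hi⟩
    · exact absurd h (Set.notMem_empty _)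
    · exact ⟨i, hi, hvi⟩

/-! ### §2b The landed host (CLOSED in the tree; the three statements below are now PROVED by the imported landed theorems — lead c1, 2026-08-16) -/

/-- **HOST 1 — term-gate collapse `Lin ∘ OR ⊆ Lin` (LANDED: `Theorems/ConvexRankGatesLinAlgGateBlindTermCollapse.lean`,
`…DnfInvariantWideGatesSeeSmallCliques.stub_termCollapse`, 0 sorry; restated verbatim).** A PERM (resp. GRANK) gate
of parameter `s` fed with small-clique DNFs `⌈A_i⌉`, `A_i ⊆ 𝒱(l)`, is ONE PERM (resp. GRANK) term gate of parameter
`s` over the atoms. Replace by the import once its olean is served. -/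
theorem stub_termCollapse :
    ∀ (m s l : ℕ) (g : GateFn) (A : Fin g.1 → Finset (Finset (Fin m))),
      (∀ i, A i ⊆ smallSets (Fin m) l) →
        (IsPermGate s g → IsTermGate m (IsPermGate s) l fun x => g.2 fun i => acceptsB (A i) x) ∧
        (IsGRankGate s g → IsTermGate m (IsGRankGate s) l fun x => g.2 fun i => acceptsB (A i) x) :=
  Summit.PneNP.PneNP.Cruxes.LinAlgGateBlind.DnfInvariantWideGatesSeeSmallCliques.stub_termCollapse

/-- **HOST 2 — plucking under `G(m,q)` (LANDED: `Theorems/ConvexRankGatesLinAlgGateBlindPluckingBound.lean`,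
`…DnfInvariantWideGatesSeeSmallCliques.stub_pluckingBound`, 0 sorry; restated verbatim).** Closing a family
`𝒞 ⊆ 𝒱(l)` in `K(m, r, l)` wrongly accepts a `q`-random graph with probability `≤ |𝒱(l)|·(1 - q^{C(l,2)})^r`.
Replace by the import once its olean is served. -/
theorem stub_pluckingBound :
    ∀ (m r l : ℕ) (q : ℝ), 0 ≤ q → q ≤ 1 → ∀ 𝒞 : Finset (Finset (Fin m)), 𝒞 ⊆ smallSets (Fin m) l →
      prob q (fun x : KEdge m → Bool => Accepts (closure r l 𝒞) x ∧ ¬ Accepts 𝒞 x)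
        ≤ (#(smallSets (Fin m) l) : ℝ) * (1 - q ^ (l.choose 2)) ^ r :=
  Summit.PneNP.PneNP.Cruxes.LinAlgGateBlind.DnfInvariantWideGatesSeeSmallCliques.stub_pluckingBound

/-- **HOST 3 — the approximation-method host with wide gates (LANDED:
`Theorems/ConvexRankGatesLinAlgGateBlindWideApproxHost.lean`, `…DnfInvariantWideGatesSeeSmallCliques.stub_wideApproxHost`,
0 sorry; restated verbatim).** For a set `W` of monotone gate functions with per-gate one-sided approximators
(`GateApprox`), no circuit over `{∧₂,∨₂} ∪ W` with `≤ t` gates computes `CLIQUE(m,k)` once `t·εP < 1` and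
`t·εN + Pr[G(m,q) ⊇ K_k] < q^{C(l,2)}`. Replace by the import once its olean is served. -/
theorem stub_wideApproxHost :
    ∀ (m k r l t : ℕ) (q εP εN : ℝ) (W : Set GateFn),
      2 ≤ r → 2 ≤ l → k ≤ m → 0 ≤ q → q ≤ 1 → 0 ≤ εP → 0 ≤ εN →
      (∀ g ∈ W, Monotone g.2) →
      (∀ A B : Finset (Finset (Fin m)), IsClosedFamily r l A → IsClosedFamily r l B →
        prob q (fun x : KEdge m → Bool => Accepts (closure r l (A ∪ B)) x ∧ ¬ Accepts (A ∪ B) x) ≤ εN) →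
      (∀ A B : Finset (Finset (Fin m)), IsClosedFamily r l A → IsClosedFamily r l B →
        (#(errPos k A B) : ℝ) ≤ εP * (m.choose k : ℝ)) →
      (∀ g ∈ W, GateApprox m k r l q εP εN g) →
      (t : ℝ) * εP < 1 →
      (t : ℝ) * εN + prob q (fun x : KEdge m → Bool => cliqueFn m k x = true) < q ^ (l.choose 2) →
      ∀ C : Circuit (KEdge m), C.IsOver (monotoneBasis ∪ W) → C.size ≤ t →
        ¬ C.Computes (cliqueFn m k) :=
  Summit.PneNP.PneNP.Cruxes.LinAlgGateBlind.DnfInvariantWideGatesSeeSmallCliques.stub_wideApproxHost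

/-- Statement of HOST 1 (for the name-keyed alias). [folklore] -/
def TermCollapse : Prop :=
  ∀ (m s l : ℕ) (g : GateFn) (A : Fin g.1 → Finset (Finset (Fin m))),
    (∀ i, A i ⊆ smallSets (Fin m) l) →
      (IsPermGate s g → IsTermGate m (IsPermGate s) l fun x => g.2 fun i => acceptsB (A i) x) ∧
      (IsGRankGate s g → IsTermGate m (IsGRankGate s) l fun x => g.2 fun i => acceptsB (A i) x)

/-- Statement of HOST 2 (for the name-keyed alias). [folklore] -/
def PluckingBound : Prop :=
  ∀ (m r l : ℕ) (q : ℝ), 0 ≤ q → q ≤ 1 → ∀ 𝒞 : Finset (Finset (Fin m)), 𝒞 ⊆ smallSets (Fin m) l →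
    prob q (fun x : KEdge m → Bool => Accepts (closure r l 𝒞) x ∧ ¬ Accepts 𝒞 x)
      ≤ (#(smallSets (Fin m) l) : ℝ) * (1 - q ^ (l.choose 2)) ^ r

/-- Statement of HOST 3 (for the name-keyed alias). [folklore] -/
def WideApproxHost : Prop :=
  ∀ (m k r l t : ℕ) (q εP εN : ℝ) (W : Set GateFn),
    2 ≤ r → 2 ≤ l → k ≤ m → 0 ≤ q → q ≤ 1 → 0 ≤ εP → 0 ≤ εN →
    (∀ g ∈ W, Monotone g.2) →
    (∀ A B : Finset (Finset (Fin m)), IsClosedFamily r l A → IsClosedFamily r l B →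
      prob q (fun x : KEdge m → Bool => Accepts (closure r l (A ∪ B)) x ∧ ¬ Accepts (A ∪ B) x) ≤ εN) →
    (∀ A B : Finset (Finset (Fin m)), IsClosedFamily r l A → IsClosedFamily r l B →
      (#(errPos k A B) : ℝ) ≤ εP * (m.choose k : ℝ)) →
    (∀ g ∈ W, GateApprox m k r l q εP εN g) →
    (t : ℝ) * εP < 1 →
    (t : ℝ) * εN + prob q (fun x : KEdge m → Bool => cliqueFn m k x = true) < q ^ (l.choose 2) →
    ∀ C : Circuit (KEdge m), C.IsOver (monotoneBasis ∪ W) → C.size ≤ t →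
      ¬ C.Computes (cliqueFn m k)

/-! ### §2c Atom probabilities (proved; tree twins in `Theorems/ConvexRankGatesLinAlgGateBlindSGGRankCalibration.lean`) -/

/-- An edge is live for `X` iff both its endpoints lie in `X`. [folklore] -/
theorem isLive_iff_endpts_subset' {m : ℕ} (X : Finset (Fin m)) (e : KEdge m) :
    IsLive X e ↔ endpts e ⊆ X :=
  ⟨fun h v hv => h v ((mem_endpts e v).1 hv), fun h v hv => h ((mem_endpts e v).2 hv)⟩

/-- `Pr_{G(m,q)}[⌈X⌉] = q^{#E(X)}`. [folklore] -/
theorem prob_cliquePresent' {m : ℕ} (q : ℝ) (X : Finset (Fin m)) :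
    prob q (fun x : KEdge m → Bool => CliquePresent X x) = q ^ #(edgesIn X) := by
  have h : ∀ x : KEdge m → Bool, CliquePresent X x ↔ ∀ e ∈ edgesIn X, x e = true := fun x => by
    simp only [CliquePresent, edgesIn, mem_filter, mem_univ, true_and, isLive_iff_endpts_subset']
  rw [prob_congr h, prob_forall_eq_true]

/-- `Pr_{G(m,q)}[⌈X⌉] ≥ q^{C(l,2)}` for `#X ≤ l`, `q ∈ [0,1]`. [folklore] -/
theorem pow_choose_le_prob_cliquePresent' {m l : ℕ} {q : ℝ} (hq0 : 0 ≤ q) (hq1 : q ≤ 1)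
    {X : Finset (Fin m)} (hX : #X ≤ l) :
    q ^ (l.choose 2) ≤ prob q (fun x : KEdge m → Bool => CliquePresent X x) := by
  rw [prob_cliquePresent']
  exact pow_le_pow_of_le_one hq0 hq1 ((card_edgesIn_le X).trans (Nat.choose_le_choose 2 hX))

/-! ### §3 The four stub STATEMENTS (named `Prop`s) and the refined target `SGGRank` -/

/-- Statement of STUB 1 — SG FOR PERM TERM GATES (research; SHARED verbatim with the picked line
`dnf-invariant-wide-gates-see-small-cliques`, whose registered `stub_sgPerm` has this exact signature over the
landed `Defs`). [folklore] -/
def SGPerm : Prop :=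
  ∀ c : ℕ, ∀ᶠ m : ℕ in atTop, SGAt m (IsPermGate (m ^ c)) (lOf m) (kOf m) (qOf m) (epsOf c m)

/-- Statement of STUB 2 — KŐNIG–EGERVÁRY DUALITY for patterns (Kőnig 1931 / Egerváry 1931; provable now from
Mathlib's Hall theorem `Finset.all_card_le_biUnion_card_iff_exists_injective` via the defect form): if every
vertex cover of `P ⊆ [d]²` has at least `θ` vertices, `P` has a `θ`-matching. [folklore] -/
def KonigDualityStmt : Prop :=
  ∀ (d θ : ℕ) (P : Set (Fin d × Fin d)),
    (∀ A W : Finset (Fin d), IsCover A W P → θ ≤ #A + #W) → HasMatching θ P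

/-- Statement of STUB 3 — SG FOR HALL-COVER (= KÖNIG) TERM GATES (research, LOAD-BEARING, NEW): at `δ = 1/8`,
for every `c`, eventually every Hall-cover gate of dimension `≤ m^c` over `≤ lOf m`-atoms is one-sidedly
`epsOf c m`-close on (bare `kOf m`-cliques) × `G(m, qOf m)` to some small-clique DNF. [folklore] -/
def SGHallCover : Prop :=
  ∀ c : ℕ, ∀ᶠ m : ℕ in atTop, SGAt m (IsHallCoverGate (m ^ c)) (lOf m) (kOf m) (qOf m) (epsOf c m)

/-- Statement of STUB 4 — SG FOR ESSENTIALLY-CANCELLING GRANK TERM GATES (research; the quarantined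
Valiant-hard residue): the SG approximator clause for every GRANK term gate of dimension `≤ m^c` over
`≤ lOf m`-atoms whose FUNCTION is not a König term gate of dimension `≤ m^c` over `≤ lOf m`-atoms. [folklore] -/
def SGCancelling : Prop :=
  ∀ c : ℕ, ∀ᶠ m : ℕ in atTop, ∀ O : (KEdge m → Bool) → Bool,
    IsTermGate m (IsGRankGate (m ^ c)) (lOf m) O → ¬ IsTermGate m (IsKonigGate (m ^ c)) (lOf m) O →
      ∃ 𝒜 ⊆ smallSets (Fin m) (lOf m),
        (#(lostPos m (kOf m) O 𝒜) : ℝ) ≤ epsOf c m * (m.choose (kOf m) : ℝ) ∧ gainedNeg m (qOf m) O 𝒜 ≤ epsOf c m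

/-- The REFINED TARGET: SG for all GRANK term gates — verbatim the picked line's registered `stub_sgGRank`
statement; here a CONSEQUENCE of stubs 2–4 (`sgGRank_of_split`), not a stub. [folklore] -/
def SGGRank : Prop :=
  ∀ c : ℕ, ∀ᶠ m : ℕ in atTop, SGAt m (IsGRankGate (m ^ c)) (lOf m) (kOf m) (qOf m) (epsOf c m)

/-! ### §4 The four registered stubs of the line (`sorry` lives ONLY in these and the three host restatements of §2b) -/

/-- **Stub 1 — SG for PERM term gates (research; shared with the picked line).** For a permutation-group
membership gate `O(x) = [τ ∈ ⟨σ_a : ⌈X_a⌉(x)⟩]` on `≤ m^c` points over atoms `X_a ∈ 𝒱(l)`: EITHER `O` rejects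
`≤ ε` of `G(m,q)` (`𝒜 = {∅}`, tree `sgAt_trivial_of_prob_reject_le`), OR all but `ε C(m,k)` of its accepted
bare `k`-cliques are accepted through a small sub-clique (tree `sg_of_locality`), OR a mixed DNF exists (tree
`sgAt_of_partition`, `sgAt_of_plantedFamily`, registered `sg_of_maxtermCover`). Abelian `σ_a` = monotone span
programs over `ℤ/q'` with atom-labelled rows (Gál 2001 rank measure, Pitassi–Robere 2018 lifting). Why it might
be false: a poly-point membership gate detecting mid-range cliques distributionally (none known; the Disproof's
one-gate CLIQUE needs `2 + C(m,k)(#E-1)` points, `Negative.exists_onePermGate_computes_cliqueFn`). -/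
theorem stub_sgPerm :
    ∀ c : ℕ, ∀ᶠ m : ℕ in atTop, SGAt m (IsPermGate (m ^ c)) (lOf m) (kOf m) (qOf m) (epsOf c m) := by
  sorry

/-- **Stub 2 — Kőnig–Egerváry duality (provable now, M-sized).** Mathlib has Hall's marriage theorem
(`Finset.all_card_le_biUnion_card_iff_exists_injective`) but not Kőnig's `ν = τ`. Route: DEFECT HALL — adjoin
`d` dummy columns adjacent to every row… or directly: let `δ := max_{S ⊆ rows} (#S - #N(S))` (neighbourhoods in
`P`); Hall on the relation "row `a` ~ column `w` or dummy `t < δ`" gives a matching of all rows using `≤ δ`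
dummies, i.e. a `P`-matching of size `d - δ`; the cover `(rows ∖ S*) ∪ N(S*)` for a maximiser `S*` has
`d - δ` vertices, so the hypothesis gives `θ ≤ d - δ` and the `(d-δ)`-matching restricts to a `θ`-matching
(`Fin.castLEEmb`). Degenerate `θ = 0`: empty matching; `θ > d`: the cover `(univ, ∅)` has `d < θ` vertices, so
the hypothesis fails — consistent. -/
theorem stub_konigDuality :
    ∀ (d θ : ℕ) (P : Set (Fin d × Fin d)),
      (∀ A W : Finset (Fin d), IsCover A W P → θ ≤ #A + #W) → HasMatching θ P :=
  fun d θ P h => Summit.PneNP.PneNP.Theorems.konigDuality_pattern d θ P fun A W hAW => h A W hAW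

/-- **Stub 3 — SG for Hall-cover (König) term gates (research; LOAD-BEARING, the line's new content).**
`O(x) = 0 ↔ ∃ (A, W), #A + #W < θ, covering P₀ and every P_a with ⌈X_a⌉(x) = 1` (`d ≤ m^c`, atoms
`X_a ∈ 𝒱(l)`). STRUCTURE a proof can use (the card's (1)–(3), sharpened by triage r1-2/r1-3): a rejecting
cover is an AND over the rectangle `Aᶜ × Wᶜ` of "all owning atoms absent" — a PRODUCT event under `G(m,q)`;
only covers whose atom-set `T_{(A,W)} = {a : P_a ∩ (Aᶜ × Wᶜ) ≠ ∅}` has `Pr[all absent] ≥ ε/4^d` matter; every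
such `T` must meet (the atom closure of) every ACCEPTED bare clique. KNOWN RANGES: (door version, all cliques
accepted, edge atoms) counting `4^d · ρ^{m²/(2k)}` kills `d ≤ m^{2-δ}/polylog` (card BN2, r1-2); (SG version) the
registered planting theorem `sg_of_maxtermCover` with `N ≤ 4^d` covers, `η = ε/#𝒱(l)`, `ν ≈ 2d + O(l log m)`,
`t = ⌊l/2⌋` gives `#lostPos ≤ (ν C(l,2))^t C(m-t, k-t) ≤ (ν l² k/(2m))^t C(m,k)` with `l² k ≤ k²/(4 log₂ m) =
m^{1/4}/(4 log₂ m)`, so `#lostPos ≤ ε C(m,k)` as soon as `d ≤ m^{3/4-γ}` for a fixed `γ > 0` (the ratio is then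
`m^{-γ l/2} ≪ m^{-(c+1)}`) — so the OPEN part is `m^{3/4} ≲ d ≤ m^c`. Handles beyond counting: FKG/Janson over
the row events,
matching-sunflower plucking with rows as vertices (Cavalar–et al. 2025, arXiv:2507.16105), locality escape
(`sg_of_locality`: a `θ`-matching of ATOMS inside `K_S` uses `≤ θ` atoms, so gates with `θ l' ≤ l` are local).
Why it might be false: a `d = m^c` pattern table realising a mid-range clique DETECTOR (accepts `> ε C(m,k)` bare
cliques non-locally, rejects `> 1/2 + ε` of `G(m,q)`; Disproof `PickedLineCopy.not_hasApprox_of_dense_of_reject`)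
— i.e. CLIQUE-detection as a monotone projection of BPM_{m^c} over `≤ l`-clique atoms (Skyum–Valiant 1985;
Grigni–Sipser 1992: open since Stockmeyer); the known constructions need `d = m^{Θ(k)}`. No algebraic barrier
applies (no cancellation); not a rank-measure/lifting statement. -/
theorem stub_sgHallCover :
    ∀ c : ℕ, ∀ᶠ m : ℕ in atTop, SGAt m (IsHallCoverGate (m ^ c)) (lOf m) (kOf m) (qOf m) (epsOf c m) := by
  sorry

/-- **Stub 4 — SG for essentially-cancelling GRANK term gates (research; HARDEST, Valiant-calibrated,
quarantined).** The GRANK term gates of dimension `≤ m^c` whose function is NOT a König term gate of dimension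
`≤ m^c`: by `grank_le_konig` such a gate sits strictly below the König gate of its supports on some input, i.e.
its power comes from CANCELLATION inside mixed discriminants (ABPs with cancellation = VBP beyond monotone
projections of matching). Jointly with Stub 3 it implies SG(GRANK) (`sgGRank_of_split`) and hence, by the
tree's `sgAt_gRank_dc_lowerBound` / Disproof headline, `dc(CL_{m,⌈m^{1/8}⌉}) > m^c` over every field — a
`VNP ⊄ VBP`-strength consequence; algebraic natural proofs / rank-method caps (tree `RankMethodBarriers`,
EGOW 2018) bite on any rank-flattening proof. This line does NOT attack it; the planner-level repair pointer is
re-typing GRANK to read-≤2 / cancellation-free pencils (triage r1-2/r1-3), under which this stub disappears and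
Stub 3 becomes the whole GRANK half. Why it might be false: a poly-dimension affine pencil with wild constants
detecting mid-range cliques on the referee pair (unknown; Disproof "WHY THE CRUX RESISTS REFUTATION"). -/
theorem stub_sgCancelling :
    ∀ c : ℕ, ∀ᶠ m : ℕ in atTop, ∀ O : (KEdge m → Bool) → Bool,
      IsTermGate m (IsGRankGate (m ^ c)) (lOf m) O → ¬ IsTermGate m (IsKonigGate (m ^ c)) (lOf m) O →
        ∃ 𝒜 ⊆ smallSets (Fin m) (lOf m),
          (#(lostPos m (kOf m) O 𝒜) : ℝ) ≤ epsOf c m * (m.choose (kOf m) : ℝ) ∧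
            gainedNeg m (qOf m) O 𝒜 ≤ epsOf c m := by
  sorry

/-! ### §5 Name-keyed aliases of the seven statements (the hypotheses of the composition) -/
namespace Registered

/-- Alias of `TermCollapse` keyed by the registered (landed) stub name. -/
abbrev stub_termCollapse : Prop := TermCollapse
/-- Alias of `PluckingBound` keyed by the registered (landed) stub name. -/
abbrev stub_pluckingBound : Prop := PluckingBound
/-- Alias of `WideApproxHost` keyed by the registered (landed) stub name. -/
abbrev stub_wideApproxHost : Prop := WideApproxHost
/-- Alias of `SGPerm` keyed by the registered stub name. -/
abbrev stub_sgPerm : Prop := SGPerm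
/-- Alias of `KonigDualityStmt` keyed by the registered stub name. -/
abbrev stub_konigDuality : Prop := KonigDualityStmt
/-- Alias of `SGHallCover` keyed by the registered stub name. -/
abbrev stub_sgHallCover : Prop := SGHallCover
/-- Alias of `SGCancelling` keyed by the registered stub name. -/
abbrev stub_sgCancelling : Prop := SGCancelling

end Registered

/-! ### §6 Proved glue: duality of the two presentations, the split of SG(GRANK), the door corollary -/

/-- **Kőnig–Egerváry for gates**: given the duality, a gate is a König gate of dimension `≤ s` iff it is a
Hall-cover gate of dimension `≤ s` (same pattern data). [folklore] -/
theorem isHallCoverGate_iff_isKonigGate (hKD : KonigDualityStmt) {s : ℕ} {g : GateFn} :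
    IsHallCoverGate s g ↔ IsKonigGate s g := by
  -- pointwise: `HasMatching θ Q ↔ ¬ ∃ small cover of Q`
  have key : ∀ (d θ : ℕ) (Q : Set (Fin d × Fin d)),
      HasMatching θ Q ↔ ¬ ∃ A W : Finset (Fin d), #A + #W < θ ∧ IsCover A W Q := by
    intro d θ Q
    constructor
    · rintro hM ⟨A, W, hlt, hcov⟩
      exact absurd (cover_card_ge_of_hasMatching hM hcov) (not_le.2 hlt)
    · intro hno
      exact hKD d θ Q fun A W hcov => not_lt.1 fun hlt => hno ⟨A, W, hlt, hcov⟩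
  constructor
  · rintro ⟨d, θ, hd, P₀, P, hg⟩
    refine ⟨d, θ, hd, P₀, P, fun v => ?_⟩
    rw [key, ← hg v]
    cases g.2 v <;> simp
  · rintro ⟨d, θ, hd, P₀, P, hg⟩
    refine ⟨d, θ, hd, P₀, P, fun v => ?_⟩
    have h := hg v
    rw [key] at h
    constructor
    · intro hf
      by_contra hno
      have := h.2 hno
      rw [hf] at this
      exact Bool.false_ne_true this
    · rintro hex
      cases hv : g.2 v with
      | false => rfl
      | true => exact absurd hex (h.1 hv)

/-- Term gates transport along an inclusion of gate classes. [folklore] -/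
theorem isTermGate_mono_class {m l : ℕ} {P Q : GateFn → Prop} (hPQ : ∀ g, P g → Q g)
    {O : (KEdge m → Bool) → Bool} (h : IsTermGate m P l O) : IsTermGate m Q l O := by
  obtain ⟨g, hg, X, hX, hO⟩ := h
  exact ⟨g, hPQ g hg, X, hX, hO⟩

/-- **THE SPLIT (PROVED).** SG for all GRANK term gates follows from Kőnig duality (Stub 2), SG for Hall-cover
term gates (Stub 3) and SG for the essentially-cancelling GRANK term gates (Stub 4): a GRANK term gate either IS a
König term gate of parameter `m^c` — then, read in the dual presentation, Stub 3 approximates it — or it is not,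
and Stub 4 applies. This refines the picked line's `stub_sgGRank`. -/
theorem sgGRank_of_split (hKD : Registered.stub_konigDuality) (hHall : Registered.stub_sgHallCover)
    (hCanc : Registered.stub_sgCancelling) : SGGRank := by
  intro c
  filter_upwards [hHall c, hCanc c] with m hH hC O hO
  by_cases hK : IsTermGate m (IsKonigGate (m ^ c)) (lOf m) O
  · exact hH O (isTermGate_mono_class (fun g hg => (isHallCoverGate_iff_isKonigGate hKD).2 hg) hK)
  · exact hC O hO hK

/-- Enlarging the approximating family can only shrink the set of lost positives. [folklore] -/
theorem lostPos_anti {m k : ℕ} (O : (KEdge m → Bool) → Bool) {𝒜 ℬ : Finset (Finset (Fin m))}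
    (h : 𝒜 ⊆ ℬ) : lostPos m k O ℬ ⊆ lostPos m k O 𝒜 := by
  intro S hS
  simp only [lostPos, mem_filter] at hS ⊢
  exact ⟨hS.1, hS.2.1, fun hacc => hS.2.2 (hacc.mono h)⟩

/-- Replacing `𝒜` by a family `ℬ` gains at most the `G(m,q)`-mass of `[⌈ℬ⌉ ∧ ¬⌈𝒜⌉]` (union bound).
[folklore] -/
theorem gainedNeg_le_add {m : ℕ} {q : ℝ} (hq0 : 0 ≤ q) (hq1 : q ≤ 1) (O : (KEdge m → Bool) → Bool)
    (𝒜 ℬ : Finset (Finset (Fin m))) :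
    gainedNeg m q O ℬ ≤ gainedNeg m q O 𝒜 +
      prob q (fun x : KEdge m → Bool => Accepts ℬ x ∧ ¬ Accepts 𝒜 x) := by
  unfold gainedNeg
  calc prob q (fun x : KEdge m → Bool => O x = false ∧ Accepts ℬ x)
      ≤ prob q (fun x : KEdge m → Bool =>
          (O x = false ∧ Accepts 𝒜 x) ∨ (Accepts ℬ x ∧ ¬ Accepts 𝒜 x)) :=
        prob_mono hq0 hq1 fun x hx => by
          by_cases h𝒜 : Accepts 𝒜 x
          · exact Or.inl ⟨hx.1, h𝒜⟩
          · exact Or.inr ⟨hx.2, h𝒜⟩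
    _ ≤ _ := prob_or_le hq0 hq1 _ _

/-- **The card's first lemma is a corollary (DOOR version of layer (i), PROVED from SG).** If `SGAt` holds for
a class `P` at `(m, l, k, q, ε)` with `k ≤ m`, `ε < 1`, `q ∈ [0,1]`, then every `P`-term gate that accepts EVERY
bare `k`-clique rejects at most `(1 - q^{C(l,2)}) + ε` of `G(m,q)` (`≤ 1/2 + ε` in the line's regime): the SG
family is non-empty (else all `C(m,k) > ε C(m,k)` cliques are lost), so it fires with probability `≥ q^{C(l,2)}`,
and it may fire on a rejected graph only with probability `≤ ε`. For `P = IsHallCoverGate (m^c)` and edge atoms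
(`atomB (endpts e) = x e`, tree `atomB_endpts`) this is the card's `matchingGate_blind` in the `G(m,q)` model:
"CLIQUE on the referee pair is not a monotone bounded-OR-projection of BPM_{m^c}". [folklore] -/
theorem door_of_sgAt {m l k : ℕ} {q ε : ℝ} {P : GateFn → Prop} (hq0 : 0 ≤ q) (hq1 : q ≤ 1) (hkm : k ≤ m)
    (hε : ε < 1) (hSG : SGAt m P l k q ε) (O : (KEdge m → Bool) → Bool) (hO : IsTermGate m P l O)
    (hacc : ∀ S : Finset (Fin m), #S = k → O (cliqueVec S) = true) :
    prob q (fun x : KEdge m → Bool => O x = false) ≤ (1 - q ^ (l.choose 2)) + ε := by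
  classical
  obtain ⟨𝒜, h𝒜, hlost, hgain⟩ := hSG O hO
  rcases 𝒜.eq_empty_or_nonempty with rfl | ⟨X, hX⟩
  · -- empty family: every `k`-set is lost, contradicting `ε < 1`
    exfalso
    have hall : lostPos m k O ∅ = powersetCard k (univ : Finset (Fin m)) := by
      refine filter_true_of_mem fun S hS => ⟨hacc S (mem_powersetCard.1 hS).2, ?_⟩
      rintro ⟨W, hW, -⟩
      exact notMem_empty W hW
    rw [hall, card_powersetCard, card_univ, Fintype.card_fin] at hlost
    have hpos : (0 : ℝ) < m.choose k := by exact_mod_cast Nat.choose_pos hkm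
    have : (1 : ℝ) * (m.choose k : ℝ) ≤ ε * (m.choose k : ℝ) := by rw [one_mul]; exact hlost
    have := le_of_mul_le_mul_right this hpos
    linarith
  · have hXl : #X ≤ l := (mem_smallSets.1 (h𝒜 hX)).1
    -- `Pr[⌈𝒜⌉] ≥ Pr[⌈X⌉] ≥ q^{C(l,2)}`
    have hAccPr : q ^ (l.choose 2) ≤ prob q (fun x : KEdge m → Bool => Accepts 𝒜 x) :=
      (pow_choose_le_prob_cliquePresent' hq0 hq1 hXl).trans (prob_mono hq0 hq1 fun x hx => ⟨X, hX, hx⟩)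
    -- `Pr[O = 0] = Pr[O = 0 ∧ ⌈𝒜⌉] + Pr[O = 0 ∧ ¬⌈𝒜⌉] ≤ gainedNeg + (1 - Pr[⌈𝒜⌉])`
    have hsplit := prob_eq_add_prob_and_not q (fun x : KEdge m → Bool => O x = false) (fun x => Accepts 𝒜 x)
    have hcomp : prob q (fun x : KEdge m → Bool => O x = false ∧ ¬ Accepts 𝒜 x) ≤
        1 - prob q (fun x : KEdge m → Bool => Accepts 𝒜 x) := by
      rw [← prob_not]
      exact prob_mono hq0 hq1 fun x hx => hx.2
    unfold gainedNeg at hgain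
    linarith

/-- **Door corollary in the line's regime** (from Stub 3 alone plus the landed dense regime): for every `c`,
eventually, a Hall-cover term gate of dimension `≤ m^c` over `≤ lOf m`-atoms that accepts every bare
`kOf m`-clique rejects at most `1/2 + epsOf c m ≤ 1/2 + 1/16` of `G(m, qOf m)`, while CLIQUE rejects `≥ 3/4`
of it — the `c`-uniform, in-Lean form of the card's `matchingGate_blind`. -/
theorem konigDoor_of_sg (hHall : Registered.stub_sgHallCover) :
    ∀ c : ℕ, ∀ᶠ m : ℕ in atTop, ∀ O : (KEdge m → Bool) → Bool,
      IsTermGate m (IsHallCoverGate (m ^ c)) (lOf m) O →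
      (∀ S : Finset (Fin m), #S = kOf m → O (cliqueVec S) = true) →
        prob (qOf m) (fun x : KEdge m → Bool => O x = false) ≤ 1 / 2 + epsOf c m := by
  intro c
  filter_upwards [hHall c, stub_denseRegime c, eventually_ge_atTop 1] with m hH hR hm O hO hacc
  obtain ⟨hl, hr, hkm, hq0, hq1, hpl, hand, heps, hclq, hhalf⟩ := hR
  have hε1 : epsOf c m < 1 := by
    have h1 : (1 : ℝ) ≤ ((m ^ c : ℕ) : ℝ) := by exact_mod_cast Nat.one_le_pow c m hm
    have hε0 : 0 ≤ epsOf c m := epsOf_nonneg c m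
    nlinarith
  have h := door_of_sgAt hq0 hq1 hkm hε1 hH O hO hacc
  linarith

/-! ### §7 The kernel-checked composition -/

/-- **Composition.** The seven stub statements imply the crux BY NAME. Take `δ = 1/8`; SG(GRANK) is
`sgGRank_of_split` of Stubs 2–4; for each `c` intersect the `∀ᶠ m` filters of the imported dense regime
(`stub_denseRegime`, landed) and of SG(PERM)/SG(GRANK); at such an `m` feed the host (`hHost`) with `W := Lin (m^c)`,
`t := m^c`, `εP := ε`, `εN := 2ε`: the `∨`-hypothesis is the plucking bound within budget, the `∧`-hypothesis is the
tree's `card_errPos_le_wide` within budget, and a `Lin` gate over closed children collapses (`hColl`) to a term gate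
of its own class, gets an SG approximator `𝒜`, and `𝒜*` is the closed
approximator (`lostPos_anti`; `gainedNeg_le_add` + plucking); endgame budgets `m^c ε ≤ 1/16` and
`2/16 + 1/4 < 1/2 ≤ q^{C(l,2)}`. No `sorry`. -/
theorem LinAlgGateBlind_of (hPerm : Registered.stub_sgPerm) (hHall : Registered.stub_sgHallCover)
    (hCanc : Registered.stub_sgCancelling) :
    Summit.PneNP.PneNP.Theses.ConvexRankGates.LinAlgGateBlind := by
  -- the four LANDED obligations are discharged here by the proved theorems of §2b / §4 (rev 2, lead c1)
  have hColl : Registered.stub_termCollapse := stub_termCollapse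
  have hPluck : Registered.stub_pluckingBound := stub_pluckingBound
  have hHost : Registered.stub_wideApproxHost := stub_wideApproxHost
  have hKD : Registered.stub_konigDuality := stub_konigDuality
  have hGRank : SGGRank := sgGRank_of_split hKD hHall hCanc
  rw [linAlgGateBlind_iff]
  refine ⟨1 / 8, by norm_num, by norm_num, fun c => ?_⟩
  filter_upwards [stub_denseRegime c, hPerm c, hGRank c] with m hR hP hG C hC hsize
  obtain ⟨hl, hr, hkm, hq0, hq1, hpl, hand, heps, hclq, hhalf⟩ := hR
  have hε : 0 ≤ epsOf c m := epsOf_nonneg c m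
  refine hHost m (kOf m) (rOf c m) (lOf m) (m ^ c) (qOf m) (epsOf c m) (2 * epsOf c m)
    (Lin (m ^ c)) hr hl hkm hq0 hq1 hε (mul_nonneg (by norm_num) hε) (fun g hg => lin_monotone hg)
    ?_ ?_ ?_ ?_ ?_ C hC hsize
  · -- (∨): plucking within budget
    intro A B hA hB
    calc prob (qOf m) (fun x : KEdge m → Bool =>
          Accepts (closure (rOf c m) (lOf m) (A ∪ B)) x ∧ ¬ Accepts (A ∪ B) x)
        ≤ (#(smallSets (Fin m) (lOf m)) : ℝ) * (1 - qOf m ^ ((lOf m).choose 2)) ^ rOf c m :=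
          hPluck m (rOf c m) (lOf m) (qOf m) hq0 hq1 (A ∪ B) (union_subset hA.subset hB.subset)
      _ ≤ epsOf c m := hpl
      _ ≤ 2 * epsOf c m := by linarith
  · -- (∧): Alon–Boppana trimming count (tree) within budget
    intro A B hA hB
    calc (#(errPos (kOf m) A B) : ℝ)
        ≤ ((((rOf c m - 1) ^ lOf m) ^ 2 * (m - (lOf m + 1)).choose (kOf m - (lOf m + 1)) : ℕ) : ℝ) := by
          exact_mod_cast card_errPos_le_wide hr hA hB
      _ ≤ epsOf c m * (m.choose (kOf m) : ℝ) := hand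
  · -- wide gates: collapse to a term gate, SG (PERM: Stub 1; GRANK: the split), re-close
    intro g hg A hA
    have hsub : ∀ i, A i ⊆ smallSets (Fin m) (lOf m) := fun i => (hA i).subset
    obtain ⟨𝒜, h𝒜, hlost, hgain⟩ : ∃ 𝒜 ⊆ smallSets (Fin m) (lOf m),
        (#(lostPos m (kOf m) (fun x => g.2 fun i => acceptsB (A i) x) 𝒜) : ℝ)
            ≤ epsOf c m * (m.choose (kOf m) : ℝ) ∧
          gainedNeg m (qOf m) (fun x => g.2 fun i => acceptsB (A i) x) 𝒜 ≤ epsOf c m := by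
      rcases hg with hg | hg
      · exact hP _ ((hColl m (m ^ c) (lOf m) g A hsub).1 hg)
      · exact hG _ ((hColl m (m ^ c) (lOf m) g A hsub).2 hg)
    refine ⟨closure (rOf c m) (lOf m) 𝒜, isClosedFamily_closure _ _ _, ?_, ?_⟩
    · calc (#(lostPos m (kOf m) (fun x => g.2 fun i => acceptsB (A i) x)
            (closure (rOf c m) (lOf m) 𝒜)) : ℝ)
          ≤ (#(lostPos m (kOf m) (fun x => g.2 fun i => acceptsB (A i) x) 𝒜) : ℝ) := by
            exact_mod_cast card_le_card (lostPos_anti _ (subset_closure h𝒜))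
        _ ≤ epsOf c m * (m.choose (kOf m) : ℝ) := hlost
    · calc gainedNeg m (qOf m) (fun x => g.2 fun i => acceptsB (A i) x) (closure (rOf c m) (lOf m) 𝒜)
          ≤ gainedNeg m (qOf m) (fun x => g.2 fun i => acceptsB (A i) x) 𝒜 +
              prob (qOf m) (fun x : KEdge m → Bool =>
                Accepts (closure (rOf c m) (lOf m) 𝒜) x ∧ ¬ Accepts 𝒜 x) :=
            gainedNeg_le_add hq0 hq1 _ _ _
        _ ≤ epsOf c m + (#(smallSets (Fin m) (lOf m)) : ℝ) * (1 - qOf m ^ ((lOf m).choose 2)) ^ rOf c m :=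
            add_le_add hgain (hPluck m (rOf c m) (lOf m) (qOf m) hq0 hq1 𝒜 h𝒜)
        _ ≤ 2 * epsOf c m := by linarith
  · -- positive-side budget: `m^c ε ≤ 1/16 < 1`
    exact lt_of_le_of_lt heps (by norm_num)
  · -- negative-side budget: `2 m^c ε + Pr[clique] ≤ 1/8 + 1/4 < 1/2 ≤ q^{C(l,2)}`
    have h2 : ((m ^ c : ℕ) : ℝ) * (2 * epsOf c m) = 2 * (((m ^ c : ℕ) : ℝ) * epsOf c m) := by ring
    rw [h2]
    linarith

/-- **`LinAlgGateBlind_closed`** — the same composition as a CLOSED term (the crux modulo the `stub_*`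
sorries, three of which are landed theorems): the registered stubs, stated verbatim, are definitionally the named statements and feed
`LinAlgGateBlind_of`. When all four stubs land, this theorem is the sorry-free proof to propose with
`--workitem stmt-PneNP-10681`. -/
theorem LinAlgGateBlind_closed : Summit.PneNP.PneNP.Theses.ConvexRankGates.LinAlgGateBlind :=
  LinAlgGateBlind_of stub_sgPerm stub_sgHallCover stub_sgCancelling

end

end Summit.PneNP.PneNP.Cruxes.LinAlgGateBlind.KonigAtomsCancellationSplit
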